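import Summits.QuantumFields.YangMills.Theses.CoarseStiffnessTail
import Summits.QuantumFields.YangMills.Theses.FirstExitWindow
import Summits.QuantumFields.YangMills.Theorems.CoarseStiffnessTailHistoryTailOfStiffness
import Summits.QuantumFields.YangMills.Theorems.FibreConvexityTailOfFirstExitWindowTailL

/-!
# Route `CoarseStiffnessTail` — the crux `CappedCoarseStiffnessL` (stmt-QuantumFields-25301) IMPLIES the crux
# `FirstExitWindowTailL` (stmt-QuantumFields-26243) of route `FirstExitWindow`, hence both open cruxes of route
# `FibreConvexityTail` (lead's cross-route certificate, seat `ym-line-cst-p1` g2)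

KERNEL-CHECKED STAFFING FACT.  The capped coarse stiffness (one tilted partition function per RG level with free energy `O(1)` per
level-`j` plaquette) yields, by the landed chessboard + exponential-Chebyshev step of the glue file
(`CoarseStiffnessTailHistoryTailOfStiffness.perPlaquette_of_cappedStiffness`, p608186), the UNCONDITIONAL per-plaquette Gibbs tail
`Gibbs_K{θ_{b₀}(K−j) ≤ |Ū^{j}(∂p) − 1|} ≤ e^{9000L³|C₀|}·exp(−c₀·p(g_{K−j})²)` at EVERY level `1 ≤ j ≤ K`, with constants chosen BEFORE the
family `F` and the coupling `γ` (they depend on `L, b₀, p₀` only).  The first-exit event of route `FirstExitWindow`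
`{∀ k < j: Ū^{k} small} ∩ {Ū^{j} θ_{b₂}-small} ∩ {θ_{b₀}(K−j) ≤ |Ū^{j}(∂p) − 1|}` is a SUB-EVENT of that tail event (its first two
constituents are dropped), so

  `CappedCoarseStiffnessL → FirstExitWindowTailL`   (`(γ₁, C, c, N) = (γ₁, e^{9000L³|C₀|}, c₀, 0)`),

and, composing with the landed certificates `FibreConvexityTail.twoSidedTailL_of_firstExitWindowTailL` /
`towerTailL_of_firstExitWindowTailL` (p623468),

  `CappedCoarseStiffnessL → TwoSidedTailL`,  `CappedCoarseStiffnessL → TowerTailL`.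

USE (director / planners).  Among the filed finest-bad-level tail cruxes the partial order now reads, kernel-checked:
`CappedCoarseStiffnessL (25301) ⇒ FirstExitWindowTailL (26243) ⇒ {TwoSidedTailL (25567), TowerTailL (25568)}`, and each of them feeds
`UnitScaleTilt.HistoryTailL` (19936) through its route's landed glue (p608186, p613065, p609164) and `SmallFieldWidening`'s r3
(22884) through the landed certificates.  So a siege on 25301 buys everything a siege on 26243 buys; conversely 25301 is the STRONGEST
(hardest) of these obligations — a probability tail does not give a tilted free energy (Hölder cannot remove the tilt; see the
strength note in `Cruxes/CappedCoarseStiffnessL/Lines/birth.md`).  The converse implications are NOT claimed.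

HONEST SCOPE.  Conditional certificates only (pure logic + measure monotonicity on top of landed files): no crux, no rung, no summit
is proved; `YM3TorusSU2` (rung R3, a RECORD rung, not the Clay statement) is NOT proved; the Yang–Mills mass gap is NOT touched.
References: J. Fröhlich, R. Israel, E. Lieb, B. Simon, CMP **62** (1978) 1–34 [FrohlichIsraelLiebSimon1978] Thm 4.1 (chessboard,
inside the cited glue lemma); T. Bałaban, CMP **102** (1985) 255–275 [Balaban1985UV3] (7) p.257, (71) p.273 (thresholds, the
large-field factor these tails formalise).
-/

noncomputable section

open MeasureTheory
open Literature.MathematicalPhysics.QuantumFieldTheory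
open Literature.MathematicalPhysics.QuantumFieldTheory.Balaban1983to89
open Literature.MathematicalPhysics.QuantumFieldTheory.Balaban1983to89.T3ContinuumYM3Torus
open Literature.MathematicalPhysics.QuantumFieldTheory.Balaban1983to89.T3UnitScaleTilt
open Literature.MathematicalPhysics.QuantumFieldTheory.Balaban1983to89.T3UnitLawDensityEML (ℰp)
open Summit.QuantumFields.YangMills.Theorems.CoarseStiffnessTailHistoryTailOfStiffness (perPlaquette_of_cappedStiffness)
open Summit.QuantumFields.YangMills.Theorems.FibreConvexityTail
  (twoSidedTailL_of_firstExitWindowTailL towerTailL_of_firstExitWindowTailL)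

namespace Summit.QuantumFields.YangMills.Theorems.CoarseStiffnessTailDownstream

/-- **`CappedCoarseStiffnessL → FirstExitWindowTailL`** (crux stmt-QuantumFields-25301 ⇒ crux stmt-QuantumFields-26243): for every `L`,
profile `(b₀, p₀)` and widening `b₂ ≥ b₀`, take `(c₀, C₀, γ₁)` from the capped stiffness at `(L, b₀, p₀)`; the glue's per-plaquette schema
(`perPlaquette_of_cappedStiffness`: chessboard at separation 1 + exponential Chebyshev on the joint event + `β_{K−j}θ² = p(g_{K−j})²`) bounds the
unconditional level-`j` tail by `e^{9000L³|C₀|}·β^0·exp(−c₀ p(g_{K−j})²)`, and the first-exit event is a sub-event of the tail event.  Constants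
`(γ₁, C, c, N) = (γ₁, e^{9000L³|C₀|}, c₀, 0)`; the widening `b₂` is idle.  Conditional certificate; both cruxes stay OPEN.
[cite: FrohlichIsraelLiebSimon1978, Thm 4.1] -/
theorem firstExitWindowTailL_of_cappedCoarseStiffnessL
    (h : Summit.QuantumFields.YangMills.Theses.CoarseStiffnessTail.CappedCoarseStiffnessL) :
    Summit.QuantumFields.YangMills.Theses.FirstExitWindow.FirstExitWindowTailL := by
  intro L b₀ p₀ b₂ hb₀ hp₀ _hb₂
  obtain ⟨c₀, C₀, γ₁, hc₀, hγ₁, hγ₁1, hbound⟩ := h L b₀ p₀ hb₀ hp₀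
  refine ⟨γ₁, Real.exp (9000 * (L : ℝ) ^ 3 * |C₀|), c₀, 0, hγ₁, hγ₁1, hc₀, ?_⟩
  intro F γ hFL hγ hγγ₁ K j hj1 hjK p
  haveI := isProbabilityMeasure_gibbsK F ℰp hγ.le K
  have hγ1 : γ ≤ 1 := hγγ₁.trans hγ₁1
  have hper := perPlaquette_of_cappedStiffness F hγ hγ1 hb₀ hc₀
    (fun K' j' hjK' => hbound F γ hFL hγ hγγ₁ K' j' hjK') K j hj1 hjK p
  rw [pow_zero, mul_one] at hper
  rw [pow_zero, mul_one, ← hFL]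
  exact (measureReal_mono (fun U hU => hU.2.2)).trans hper

/-- **`CappedCoarseStiffnessL → TwoSidedTailL`** (crux 25301 ⇒ crux stmt-QuantumFields-25567 of route `FibreConvexityTail`): composition of
`firstExitWindowTailL_of_cappedCoarseStiffnessL` with the landed `FibreConvexityTail.twoSidedTailL_of_firstExitWindowTailL` (p623468).
Conditional certificate; both cruxes stay OPEN. [cite: Balaban1985UV3, (7) p.257 and (71) p.273] -/
theorem twoSidedTailL_of_cappedCoarseStiffnessL
    (h : Summit.QuantumFields.YangMills.Theses.CoarseStiffnessTail.CappedCoarseStiffnessL) :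
    Summit.QuantumFields.YangMills.Theses.FibreConvexityTail.TwoSidedTailL :=
  twoSidedTailL_of_firstExitWindowTailL (firstExitWindowTailL_of_cappedCoarseStiffnessL h)

/-- **`CappedCoarseStiffnessL → TowerTailL`** (crux 25301 ⇒ crux stmt-QuantumFields-25568 of route `FibreConvexityTail`): composition of
`firstExitWindowTailL_of_cappedCoarseStiffnessL` with the landed `FibreConvexityTail.towerTailL_of_firstExitWindowTailL` (p623468).
Conditional certificate; both cruxes stay OPEN. [cite: Balaban1985UV3, (7) p.257 and (71) p.273] -/
theorem towerTailL_of_cappedCoarseStiffnessL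
    (h : Summit.QuantumFields.YangMills.Theses.CoarseStiffnessTail.CappedCoarseStiffnessL) :
    Summit.QuantumFields.YangMills.Theses.FibreConvexityTail.TowerTailL :=
  towerTailL_of_firstExitWindowTailL (firstExitWindowTailL_of_cappedCoarseStiffnessL h)

end Summit.QuantumFields.YangMills.Theorems.CoarseStiffnessTailDownstream

end
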